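import Summits.ResolutionOfSingularities.ResolutionOfSingularities.Theorems.ConeCutRepeats
import Summits.ResolutionOfSingularities.ResolutionOfSingularities.Theorems.MaxContactCutExitLaw
import Summits.ResolutionOfSingularities.ResolutionOfSingularities.Theorems.BoundaryLedgerClasses
import Summits.ResolutionOfSingularities.ResolutionOfSingularities.Theorems.FloorCutClasses
import Literature.AlgebraicGeometry.Resolution.HasseSchmidtDiffEqDiffOp
import HarnessLib

/-!
# ShadeCutLawJ — decomp-res node «ShadeCut» (lens-3 g16), tree file 1/4: §J **LAW J** — the corner axis law
BEFORE an untranslated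
proximity repeat (`axis_before_untranslated_repeat`; tree-letter wrapper `corner_bound_of_untranslated_repeat`),
from the landed POWER LAW
`ConeCut.resForm_eq_pow_of_repeat` + AXIS LAW `ConeCutAxisLaw.axis_law`.  PROVED, 0 sorry.  The shade-two theorem:
`ShadeCutTailTwo` /
`ShadeCutShadeTwo`; booking to 31770: `MaxContactCutShadeCut`.

## The lens's node description (VERBATIM)

TARGET (tree vocabulary, BY NAME): the tree's JOINT RESIDUAL of 31770,
`Theorems.ExitLaw.NoRepeatTranslationRecurrentExcessPlateauxDeep` (`Theorems/ExitLawClasses.lean` :171; the tree cut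
`ExitLaw.defectWalksDeep_iff_joint' : MaxContactCut.DefectWalksDeep ↔ NoFreePointTailsDeep ∧ (joint residual)` is
hypothesis-free), and lens-3 g15's located residual `NoTameMixedTailsDeep` (`ConeCut.lean` rev 5 :3713, restated
VERBATIM in §L).

NODE.  joint residual ⟸ NoShadeTwoJointTailsDeep [WINDOW (q, s = 2), all q = p^e ≥ 4 · DECIDED — PROVED EMPTY
`noShadeTwoJointTails_holds` :1668] ∧ NoJointTailsFromThreeDeep [LOCATED RESIDUAL · NECESSARY `three_of_joint` · EXACT
`joint_iff_three` :1707 (THE ONE CERTIFIED EQUIV) · UNDECIDED]; 31770 BY NAME `defectWalksDeep_of_three` :1712, EXACT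
and hypothesis-free `defectWalksDeep_iff_three` :1718; lens-3 letters: `NoTameMixedTailsDeep ↔
NoTameMixedTailsFromThreeDeep` :1807, `NoMixedTailsDeep ↔ NoMixedTailsFromThreeDeep` :1795 (EXACT); root BY NAME
`closes` :1822 (VERBATIM g15).

THE NEW LAW (§J).  **LAW J — the corner axis law BEFORE an untranslated repeat** (`axis_before_untranslated_repeat`
:1173): on a plateau of shade `n ≥ 1` with orders `> q`, if move `t+1` is a proximity repeat (`j_{t+1} ≠ j_t`,
`b_{t+1}(j_t) = 0`) which is untranslated along the third variable `k` (`b_{t+1}(k) = 0`), then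
`r_{t+1}(j_t) + r_{t+1}(k) + 1 < q`.  Proof in kernel: the POWER LAW (g15 `resForm_eq_pow_of_repeat`, carried) with
`β = 0` makes the residual cone of move `t` the axis form `c·u_k^n`; the layer identity of move `t`
(`coeff_pointTransform_layer`, `initLayer_eq_mul`, `translate_boundary_split`, carried) then gives every monomial of
`F_{t+1}` on the face `m_{j_t} = o_t − q` a `u_k`-exponent `≥ kept_t(k) + n`; the AXIS LAW (support form of isolation,
g15 `exists_support_pair_lt_of_isolatedTop`, carried) at stage `t+1` for the pair `(j_t, k)` supplies a support monomial
with `m_{j_t} + m_k < q` above the boundary — contradiction unless the corner sum is `≤ q − 2`.  (LAW I of g15 rev 5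
is the sister inequality one move later and needs the older-face law; LAW J needs only the power law.)

THE SHADE-TWO THEOREM (§S, `shadeTwo_tail_false` :1610).  For `q ≥ 4` no forced walk from a root has a tail which is
a shade-2 plateau with order `≠ q`, proximity repeats i.o. AND translated moves i.o.  Boundary-ledger proof with ONE
polynomial input (LAW J): `D_t = |r_t|`, `o_t = D_t + 2 ∈ (q, 2q)`; (L1) `D_{t+1} ≤ D_t + 1` (`degree_succ_le`);
(L2) an increase at move `t+1` needs kept mass `q − 1`, and a chart change keeping `q − 1` is an untranslated repeat
with corner sum `q − 1` — LAW J — so increases repeat the chart and chain backwards (`chart_eq_of_increase`,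
`increase_chain`); (L3) hence no increase after `q` moves and `D` is eventually constant (`noninc`,
`eventually_const`); (L4) in the constant phase (`ConstTwo`) every move keeps exactly `q − 2`: a repeat sits on
`(x, x, q−2−x)` with all three coordinates positive and freezes `r` (`repeat_move`), a same-chart move translates only
along zero coordinates and freezes `r` (`same_move`), a chart-changing translated move goes `(x,0,q−2) → (0,x,q−2)`
(`change_move`); so «`r` has a zero coordinate» is invariant, false before repeats, true before translations
(`zero_step`) — the two recurrences exclude each other.

CARRIED VERBATIM (credited, DELETE ON LANDING): §V1 = g15 `ConeCut.lean` rev 5 (pin f76e5309) l.140–214 (walk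
arithmetic); §V2 = l.881–1742 (§A state-level cone calculus, §B along walks up to the power law; the carried
`section Walks` is closed after it); §V3 = l.2960–3087 (§AxisLaw = `AxisLaw.lean` a28bef61 minus LAW I; critic row 123
h1: land ONE copy as `Theorems/ConeCutAxisLaw.lean` and replace §V3 by the import).  Everything from §J on is new.
Imports are tree-only; no HOME file is imported; `allowUnsafeReducibility` is not used; 0 sorry.

Content VERBATIM from the decomp-res lens-3 g16 file `HOME/decomp-res-lens-3/g16/ShadeCut.lean` (sha256
d031e7e4ff78d2a8…, 1829 l; CRITIC-LEDGER
row 130 CLEARED (DECIDED +1 · MAP +1), landing orders 2026-08-30T18:2xZ (row 130 rider) / 19:49:35Z (row 136: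
ShadeCut FIRST, then lens-3 g17
«TightCut» as modules importing these)).  HOME = run/shared/lean/pub/decomp-res.  Host: route `MaxContactCut`,
aside 31770 `DefectWalksDeep`
through the tree's hypothesis-free `ExitLaw.defectWalksDeep_iff_joint'` and the lens-3 g15 node `Theorems/ConeCut*` (landed).

[WRITER NOTE (decomp-res writer g7): per the lens's own DELETE-ON-LANDING markers and critic row 123 h1 / row 130,
the carried sections §V1
(g15 walk arithmetic = tree `Theorems/FloorCutFloor`), §V2 (g15 §A–§B residual-cone calculus up to the POWER
LAW = tree `Theorems/ConeCutLayers`,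
`ConeCutLayersPoint`, `ConeCutWalks`) and §V3 (§AxisLaw = tree `Theorems/ConeCutAxisLaw`) are DELETED and the tree
modules imported/opened
instead (no third copy of the calculus; `exists_ne` is spelled `FloorCut.exists_ne` against Mathlib's root one); the
lens's `exists_third` (≡ tree `ConeCut.exists_third`, implicit binders) and `degree_eq_sum3`
(≡ `Finsupp.degree_eq_sum` + `Fin.sum_univ_three`, as in `FloorCutFloor`) are likewise replaced by the tree
spellings; §L's VERBATIM g15
classes `IsTameFrom` / `NoMixedTailsDeep` / `NoTameMixedTailsDeep` are the landed `Theorems/ConeCutClasses` ones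
(opened, not restated); §M
`closes` (≡ `MaxContactCutExponentLadder.closes`, a by-name re-export) is not restated.  Split: `ShadeCutLawJ`
(§J LAW J) · `ShadeCutTailTwo` /
`ShadeCutShadeTwo` (§S the shade-two theorem, PROVED; `section ShadeTwo` re-opened) · `MaxContactCutShadeCut` (§K
booking BY NAME to 31770 + §L letters).  ONE namespace `…Theorems.ShadeCut` as in the
lens; global `set_option` line dropped; nothing else changed.]
(Sources: Hauser2010 §§D,F,G; HauserPerlega2019; Moh1987; CossartPiltant2019; CossartJannsenSaito2020 Thm. 2.14,
§§5,9; BenitoVillamayor2013 §7; CasasAlvero2000 Ch. 3.)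
-/

noncomputable section

open MvPolynomial Finset
open Literature.AlgebraicGeometry.Resolution
open Literature.AlgebraicGeometry.Resolution.Hauser2010
open Literature.AlgebraicGeometry.Resolution.PointBlowup
open Summit.ResolutionOfSingularities.ResolutionOfSingularities.Theses
open Summit.ResolutionOfSingularities.ResolutionOfSingularities.Theorems.TightDefectClasses
open Summit.ResolutionOfSingularities.ResolutionOfSingularities.Theorems.TightDefectStrongWalks
open Summit.ResolutionOfSingularities.ResolutionOfSingularities.Theorems.ItineraryCutClasses
open Summit.ResolutionOfSingularities.ResolutionOfSingularities.Theorems.BoundaryLedger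
open Summit.ResolutionOfSingularities.ResolutionOfSingularities.Theorems.ProximityCut
open Literature.AlgebraicGeometry.Resolution.WeightedBlowup
open Literature.Barriers.ResolutionOfSingularities
open Summit.ResolutionOfSingularities.ResolutionOfSingularities.Theorems.FloorCut
open Summit.ResolutionOfSingularities.ResolutionOfSingularities.Theorems.ConeCutAxisLaw
open Summit.ResolutionOfSingularities.ResolutionOfSingularities.Theorems.ConeCut
open Summit.ResolutionOfSingularities.ResolutionOfSingularities.Theorems.ExitLaw (fin3_cases)

namespace Summit.ResolutionOfSingularities.ResolutionOfSingularities.Theorems.ShadeCut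

/-! ## §J  LAW J — THE CORNER AXIS LAW BEFORE AN UNTRANSLATED REPEAT (new, g16)

At a proximity repeat the POWER LAW (`resForm_eq_pow_of_repeat`, g15) says that the residual cone of the PREVIOUS move
is the `s`-fold line through the next centre, `N_t = c · (u_k − β u_i)^s`, `β = b_{t+1}(k)`.  When the repeat is
UNTRANSLATED (`β = 0`) the line is the COORDINATE AXIS `u_k = 0`: `N_t = c · u_k^s`.  Feeding this into the layer
identity of move `t` shows that every monomial of `F_{t+1}` on the face `m_{j_t} = r_{t+1}(j_t)` carries `u_k`-exponent
`≥ r_{t+1}(k) + s`; the AXIS LAW (support form of isolation at stage `t+1`, pair `(j_t, k)`) then forces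
`r_{t+1}(j_t) + r_{t+1}(k) + 1 < q`: **newest mass + third mass ≤ q − 2 in front of every untranslated repeat.**
(LAW I of g15 is the same inequality one move LATER and needs the older-face law; LAW J is one move EARLIER, needs only
the power law, and is the law that bites at shade 2.) -/

section LawJ

variable {K : Type} [Field K] [DecidableEq K] {q : ℕ} {s₀ : State (Fin 3) K}

/-- **LAW J — THE CORNER AXIS LAW (PROVED).**  Plateau `t → t+1 → t+2` of shade `n ≥ 1` from orders `o_t, o_{t+1} > q`;
move `t+1` a proximity repeat (`j_{t+1} ≠ j_t`, `b_{t+1}(j_t) = 0`) that is UNTRANSLATED along the third variable `k`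
(`b_{t+1}(k) = 0`).  Then `r_{t+1}(j_t) + r_{t+1}(k) + 1 < q`. [new] [folklore] -/
theorem axis_before_untranslated_repeat (hroot : IsRoot q s₀) (W : ForcedWalk q s₀) (t : ℕ) {o o' : ℕ}
    (ho : ordZero (W.st t).F = o) (ho' : ordZero (W.st (t + 1)).F = o') (hqo : q < o) (hqo' : q < o')
    (hplat : (W.st (t + 1)).shade = (W.st t).shade) (hplat' : (W.st (t + 2)).shade = (W.st (t + 1)).shade)
    {n : ℕ} (hn : (W.st t).shade = (n : ℕ∞)) (hn1 : 1 ≤ n) (hS : W.j (t + 1) ≠ W.j t ∧ W.b (t + 1) (W.j t) = 0)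
    {k : Fin 3} (hki : k ≠ W.j (t + 1)) (hkj : k ≠ W.j t) (hbk : W.b (t + 1) k = 0) :
    (W.st (t + 1)).r (W.j t) + (W.st (t + 1)).r k + 1 < q := by
  classical
  -- the power law with `β = 0`: `N_t = c · u_k ^ n`
  obtain ⟨c, -, hpow⟩ := resForm_eq_pow_of_repeat hroot W t ho ho' hqo hqo' hplat hplat' hn hS hki hkj
  rw [hbk, map_zero, zero_mul, sub_zero] at hpow
  -- the ledger of move `t`
  have hr₁ : (W.st (t + 1)).r = kept W t + Finsupp.single (W.j t) (o - q) := r_succ_eq W t ho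
  have hr₁j : (W.st (t + 1)).r (W.j t) = o - q := by
    rw [hr₁, Finsupp.add_apply, kept_apply, if_neg (fun h => h.1 rfl), Finsupp.single_eq_same, zero_add]
  have hr₁k : (W.st (t + 1)).r k = kept W t k := by
    rw [hr₁, Finsupp.add_apply, Finsupp.single_eq_of_ne hkj, add_zero]
  -- the AXIS LAW at `t+1` for the pair `(j_t, k)`
  obtain ⟨m, hm, hlt⟩ := exists_support_pair_lt_of_isolatedTop (W.isolated (t + 1)) (W.j t) k hkj.symm
  have hrm : (W.st (t + 1)).r ≤ m := walk_r hroot W (t + 1) m hm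
  have hmj : (W.st (t + 1)).r (W.j t) ≤ m (W.j t) := Finsupp.le_def.mp hrm (W.j t)
  have hmk : (W.st (t + 1)).r k ≤ m k := Finsupp.le_def.mp hrm k
  by_contra hge
  have hmj' : m (W.j t) = o - q := by omega
  have hmk' : m k = (W.st (t + 1)).r k := by omega
  -- transport the coefficient of `u^m` to the translated initial layer of `F_t`
  have hcoef : coeff m (W.st (t + 1)).F ≠ 0 := mem_support_iff.mp hm
  have hst : W.st (t + 1) = step q (W.j t) (W.b t) (W.st t) := W.st_succ t
  have hF : (W.st (t + 1)).F = deletePthPowers q (pointTransform q (W.j t) (W.b t) (W.st t)) := by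
    rw [hst]
    rfl
  rw [hF, coeff_deletePthPowers] at hcoef
  split_ifs at hcoef with hP
  · exact hcoef rfl
  rw [coeff_pointTransform_layer q (W.j t) (W.b t) (W.onExc t) (W.st t) (o := o) hqo hmj',
    initLayer_eq_mul (W.j t) (W.st t) (walk_r hroot W t) o,
    show PointBlowup.translate (W.b t) (monomial ((W.st t).r.update (W.j t) 0) 1 * resLayer (W.j t) (W.st t) o) =
      PointBlowup.translate (W.b t) (monomial ((W.st t).r.update (W.j t) 0) 1) *
        PointBlowup.translate (W.b t) (resLayer (W.j t) (W.st t) o) from map_mul _ _ _,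
    translate_boundary_split (W.j t) (W.b t) (W.onExc t) (W.st t).r, mul_assoc, coeff_monomial_mul'] at hcoef
  split_ifs at hcoef with hle
  swap
  · exact hcoef rfl
  rw [one_mul] at hcoef
  have hres : PointBlowup.translate (W.b t) (resLayer (W.j t) (W.st t) o) = resForm W t o := rfl
  rw [hres, hpow, ← mul_assoc, X_pow_eq_monomial, coeff_mul_monomial'] at hcoef
  split_ifs at hcoef with hle2
  swap
  · exact hcoef rfl
  -- the exponent has no room at `k`: `E(k) = m(k) − kept_t(k) = 0 < n`
  have hk := Finsupp.single_le_iff.mp hle2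
  rw [Finsupp.tsub_apply, update_apply', if_neg hkj] at hk
  have hkk : (((W.st t).r.filter (fun l => W.b t l = 0)).erase (W.j t)) k = kept W t k := rfl
  rw [hkk] at hk
  omega

/-- LAW J in the tree's letters: at an UNTRANSLATED proximity repeat (`StaysOnNewest W t`, `b_{t+1} = 0`) the newest
mass and the third mass add up to at most `q − 2`. [new] [folklore] -/
theorem corner_bound_of_untranslated_repeat (hroot : IsRoot q s₀) (W : ForcedWalk q s₀) (t : ℕ) {o o' : ℕ}
    (ho : ordZero (W.st t).F = o) (ho' : ordZero (W.st (t + 1)).F = o') (hqo : q < o) (hqo' : q < o')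
    (hplat : (W.st (t + 1)).shade = (W.st t).shade) (hplat' : (W.st (t + 2)).shade = (W.st (t + 1)).shade)
    {n : ℕ} (hn : (W.st t).shade = (n : ℕ∞)) (hn1 : 1 ≤ n) (hS : StaysOnNewest W t) (hb : W.b (t + 1) = 0)
    {k : Fin 3} (hki : k ≠ W.j (t + 1)) (hkj : k ≠ W.j t) :
    (W.st (t + 1)).r (W.j t) + (W.st (t + 1)).r k + 1 < q :=
  axis_before_untranslated_repeat hroot W t ho ho' hqo hqo' hplat hplat' hn hn1 hS hki hkj (by rw [hb]; rfl)

end LawJ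

end Summit.ResolutionOfSingularities.ResolutionOfSingularities.Theorems.ShadeCut
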